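import Summits.AnomalousDissipation.AnomalousDissipation.Theorems.ImpulseGridGridSignsCoherentTransfer

/-!
# Crux `GridSigns` (stmt-AnomalousDissipation-1771) — coherent wakes with a DETUNED-WORK floor give `GridSigns`

Second transfer of line `Sketch` (crux `GridSigns`, route ImpulseGrid), with the viscosity-free and
LINEAR form of the hypothesis: a slab⊗transverse design and a vanishing-viscosity family of
time-periodic classical wakes `u j` (period `τ j`) with drift `c`, energy `∫‖u j t‖² ≤ E` uniformly
in `j, t`, nonnegative period-mean RESONANT work `∫₀^τ (G, u j) ≥ 0` and a period-mean DETUNED-WORK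
floor `c·∫₀^τ ((Φ−1)G, u j) ≥ τ·η` (`gridSigns_of_detunedCoherentWakes`). Compared with
`gridSigns_of_coherentWakes` (`Theorems/ImpulseGridGridSignsCoherentTransfer.lean`) the `O(ν)` term
`ν∫₀^τ (u, Δ(Ψ•G))` is no longer part of the hypothesis: it is bounded by `τ·ν·‖Δ(Ψ•G)‖_∞(1+E)/2`
(`impulseGrid_abs_integral_inner_le`) and absorbed into `η/2` after discarding finitely many members
of the family (tail shift `j ↦ j + J`, `ν (j+J) → 0` still). The detuned work equals
`∫₀^τ(Φ•G,u) − ∫₀^τ(G,u) = ν∫₀^τ‖∇u‖² − ∫₀^τ(G,u)` by the period energy balance, so this is the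
same physics as the dissipation-excess form, stated on the first moments of the wake only.
No new definitions.
-/

noncomputable section

-- `Summit.<Summit>.<Problem>` is the tree's mandated summit-side namespace (CONVENTIONS §2); for this
-- single-conjunct summit the two coincide, so the duplicate is deliberate.
set_option linter.dupNamespace false

open MeasureTheory Set Filter Topology
open scoped InnerProductSpace RealInnerProductSpace

namespace Summit.AnomalousDissipation.AnomalousDissipation.Theorems.ImpulseGridGridSigns

open Literature.Analysis
open Literature.Analysis.FluidPDE
open Literature.Analysis.FunctionSpaces Literature.Analysis.FunctionSpaces.Torus
open Summit.AnomalousDissipation.AnomalousDissipation.Theses.ImpulseGrid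

section Transfer

variable {Φ Ψ : UnitAddTorus (Fin 3) → ℝ} {G : UnitAddTorus (Fin 3) → EuclideanSpace ℝ (Fin 3)}
  {ν τ : ℝ} {u : ℝ → UnitAddTorus (Fin 3) → EuclideanSpace ℝ (Fin 3)}
  {p : ℝ → UnitAddTorus (Fin 3) → ℝ}

/-- **Period detuned work = dissipation minus resonant work** along a periodic classical wake:
`∫₀^τ ∫(Φ−1)⟪G,u⟫ = ν∫₀^τ‖∇u‖₂² − ∫₀^τ (G,u)` (slice-wise `∫(Φ−1)⟪G,u⟫ = ∫⟪Φ•G,u⟫ − ∫⟪G,u⟫` and the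
period energy balance `period_work_eq_dissipation`). [folklore] -/
theorem period_detunedWork_eq
    (h : FunctionSpaces.Torus.IsClassicalNSSolutionOn Set.univ ν (fun _ => fun x => Φ x • G x) u p)
    (hΦ : IsSmooth Φ) (hG : IsSmooth G) (hper : Function.Periodic u τ) (hτ : 0 < τ) :
    ∫ t in (0 : ℝ)..τ, ∫ x, (Φ x - 1) * ⟪G x, u t x⟫ =
      ν * (∫ t in (0 : ℝ)..τ, gradNormSq (u t)) - ∫ t in (0 : ℝ)..τ, ∫ x, ⟪G x, u t x⟫ := by
  have hslice : ∀ t, ∫ x, (Φ x - 1) * ⟪G x, u t x⟫ = (∫ x, ⟪Φ x • G x, u t x⟫) - ∫ x, ⟪G x, u t x⟫ := by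
    intro t
    have hu : IsSmooth (u t) := h.smooth_velocity.isSmooth_slice (mem_univ t)
    have iF : Integrable (fun x => ⟪Φ x • G x, u t x⟫) volume :=
      ((hΦ.smul' hG).continuous.inner hu.continuous).integrable_of_hasCompactSupport
        (HasCompactSupport.of_compactSpace _)
    have iG : Integrable (fun x => ⟪G x, u t x⟫) volume :=
      (hG.continuous.inner hu.continuous).integrable_of_hasCompactSupport
        (HasCompactSupport.of_compactSpace _)
    rw [← integral_sub iF iG]
    refine integral_congr_ae (ae_of_all _ fun x => ?_)
    dsimp only
    rw [real_inner_smul_left]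
    ring
  simp_rw [hslice]
  have cF : IntervalIntegrable (fun t => ∫ x, ⟪Φ x • G x, u t x⟫) volume 0 τ :=
    (continuous_integral_inner_const h (hΦ.smul' hG)).continuousOn.intervalIntegrable
  have cG : IntervalIntegrable (fun t => ∫ x, ⟪G x, u t x⟫) volume 0 τ :=
    (continuous_integral_inner_const h hG).continuousOn.intervalIntegrable
  rw [intervalIntegral.integral_sub cF cG, period_work_eq_dissipation h hper hτ]

/-- **Coherent wakes with a detuned-work floor give `GridSigns`** (with `η/2` and the tail of the
family): for each member, `u j` is global Leray–Hopf from `u j 0`, energies are bounded by `E/2`,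
all long-time averages are period means; (a) is the nonnegative resonant work; and by the grid
injection identity, the period energy balance and `period_detunedWork_eq`,
`Λ⟨∫⟪w,(w·∇)(Ψ•G)⟫⟩ = −τ⁻¹[c·(detuned work) + ν∫₀^τ(u,Δ(Ψ•G))] ≤ −η + ν·‖Δ(Ψ•G)‖_∞(1+E)/2 ≤ −η/2`
once `ν = ν j` is small, i.e. for `j ≥ J`; the family is reindexed by `j ↦ j + J`. [folklore] -/
theorem gridSigns_of_detunedCoherentWakes :
    (∃ (Φ Ψ : UnitAddTorus (Fin 3) → ℝ) (G : UnitAddTorus (Fin 3) → EuclideanSpace ℝ (Fin 3)) (c η : ℝ),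
      IsSmooth Φ ∧ IsSmooth Ψ ∧ IsSmooth G ∧
      (∀ (s : UnitAddCircle) x, Ψ (x + Pi.single (1 : Fin 3) s) = Ψ x ∧ Ψ (x + Pi.single (2 : Fin 3) s) = Ψ x) ∧
      (∀ (s : UnitAddCircle) x, G (x + Pi.single (0 : Fin 3) s) = G x) ∧ (∀ x, G x 0 = 0) ∧ IsDivFree G ∧
      (∀ x, Torus.partialDeriv 0 Ψ x = Φ x - 1) ∧ (∫ x, Φ x * Ψ x * ‖G x‖ ^ 2 = 0) ∧
      IsSmooth (fun x => Φ x • G x) ∧ IsDivFree (fun x => Φ x • G x) ∧ HasZeroMean (fun x => Φ x • G x) ∧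
      0 < c ∧ 0 < η ∧
      ∃ (ν τ : ℕ → ℝ) (u : ℕ → ℝ → UnitAddTorus (Fin 3) → EuclideanSpace ℝ (Fin 3))
        (p : ℕ → ℝ → UnitAddTorus (Fin 3) → ℝ),
        (∀ j, 0 < ν j) ∧ Tendsto ν atTop (nhds 0) ∧
        (∀ j, FunctionSpaces.Torus.IsClassicalNSSolutionOn Set.univ (ν j) (fun _ => fun x => Φ x • G x) (u j) (p j) ∧
          0 < τ j ∧ Function.Periodic (u j) (τ j)) ∧
        (∀ j, ∫ x, u j 0 x = c • EuclideanSpace.single 0 1) ∧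
        (∃ E : ℝ, ∀ j t, ∫ x, ‖u j t x‖ ^ 2 ≤ E) ∧
        (∀ j, 0 ≤ ∫ t in (0 : ℝ)..τ j, ∫ x, ⟪G x, u j t x⟫) ∧
        (∀ j, τ j * η ≤ c * ∫ t in (0 : ℝ)..τ j, ∫ x, (Φ x - 1) * ⟪G x, u j t x⟫)) →
    GridSigns := by
  intro hC
  obtain ⟨Φ, Ψ, G, c, η, hΦ, hΨ, hG, hΨinv, hGinv, hG0, hGdiv, hΨ', hnorm, hf1, hf2, hf3, hc, hη,
    ν, τ, u, p, hν, hν0, hsol, hmom, ⟨E, hE⟩, ha, hb⟩ := hC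
  obtain ⟨Λ⟩ := (GeneralizedLimit.nonempty_holds : Nonempty GeneralizedLimit)
  -- per-`j` facts
  have hLH : ∀ j, FluidPDE.Torus.IsGlobalLerayHopf (ν j) (fun _ => fun x => Φ x • G x) (u j 0) (u j) :=
    fun j => (hsol j).1.isGlobalLerayHopf
  have hsup : ∀ j, ∀ t : ℝ, 0 ≤ t → kineticEnergy (u j t) ≤ 2⁻¹ * E := fun j t _ => by
    unfold kineticEnergy
    exact mul_le_mul_of_nonneg_left (hE j t) (by norm_num)
  have hsup' : ∀ j, ∃ C : ℝ, ∀ t : ℝ, 0 ≤ t → kineticEnergy (u j t) ≤ C := fun j => ⟨_, hsup j⟩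
  have hEnn : 0 ≤ E := le_trans (integral_nonneg fun x => sq_nonneg _) (hE 0 0)
  -- the `O(ν)` term: `|∫⟪u, Δ(Ψ•G)⟫| ≤ K₀` uniformly in `j` and `t ≥ 0`
  have hV : IsSmooth (fun y => Ψ y • G y) := hΨ.smul' hG
  obtain ⟨K, hK0, hK⟩ :=
    FluidPDE.Torus.exists_nonneg_forall_norm_le_of_continuous hV.laplacian.continuous
  set K₀ : ℝ := K * (2⁻¹ * (1 + 2 * (2⁻¹ * E))) with hK₀def
  have hK₀ : 0 ≤ K₀ := by positivity
  have hLt : ∀ j (t : ℝ), 0 ≤ t →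
      |∫ x, ⟪u j t x, Torus.laplacian (fun y => Ψ y • G y) x⟫| ≤ K₀ := fun j t ht =>
    impulseGrid_abs_integral_inner_le (hLH j) hK0 hK (hsup j) ht
  -- choose the tail: `ν j · (K₀ + 1) < η / 2` for `j ≥ J`
  have hε : 0 < η / (2 * (K₀ + 1)) := by positivity
  obtain ⟨J, hJ⟩ := eventually_atTop.1 (hν0.eventually (gt_mem_nhds hε))
  have hsmall : ∀ j, J ≤ j → ν j * K₀ ≤ η / 2 := by
    intro j hj
    have h1 : ν j < η / (2 * (K₀ + 1)) := hJ j hj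
    have h2 : ν j * K₀ ≤ ν j * (K₀ + 1) := mul_le_mul_of_nonneg_left (by linarith) (hν j).le
    have h3 : ν j * (K₀ + 1) < η / (2 * (K₀ + 1)) * (K₀ + 1) := mul_lt_mul_of_pos_right h1 (by linarith)
    have h4 : η / (2 * (K₀ + 1)) * (K₀ + 1) = η / 2 := by field_simp
    linarith
  refine ⟨Φ, Ψ, G, c, η / 2, Λ, hΦ, hΨ, hG, hΨinv, hGinv, hG0, hGdiv, hΨ', hnorm, hf1, hf2, hf3, hc,
    half_pos hη, fun j => ν (j + J), fun j => u (j + J) 0, fun j => u (j + J), fun j => hν _,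
    hν0.comp (tendsto_add_atTop_nat J), fun j => hLH _, fun j => hmom _, ⟨E, fun j => ?_⟩,
    fun j => ?_, fun j => ?_⟩
  · -- mean energy
    obtain ⟨hcl, hτ, hper⟩ := hsol (j + J)
    rw [meanEnergy_eq_longTimeAvgSup,
      longTimeAvgSup_eq_of_periodic (periodic_comp hper fun v => ∫ x, ‖v x‖ ^ 2) hτ]
    have hbound : ‖∫ t in (0 : ℝ)..τ (j + J), ∫ x, ‖u (j + J) t x‖ ^ 2‖ ≤ E * |τ (j + J) - 0| := by
      refine intervalIntegral.norm_integral_le_of_norm_le_const fun t _ => ?_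
      rw [Real.norm_of_nonneg (integral_nonneg fun x => sq_nonneg _)]
      exact hE (j + J) t
    rw [sub_zero, abs_of_pos hτ] at hbound
    calc (τ (j + J))⁻¹ * ∫ t in (0 : ℝ)..τ (j + J), ∫ x, ‖u (j + J) t x‖ ^ 2
        ≤ (τ (j + J))⁻¹ * (E * τ (j + J)) :=
          mul_le_mul_of_nonneg_left ((le_abs_self _).trans hbound) (inv_nonneg.2 hτ.le)
      _ = E := by field_simp
  · -- (a) no reversal
    obtain ⟨hcl, hτ, hper⟩ := hsol (j + J)
    rw [longTimeAvg_eq_periodMean Λ hper hτ fun v => ∫ x, ⟪G x, v x⟫]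
    exact mul_nonneg (inv_nonneg.2 hτ.le) (ha (j + J))
  · -- (b) early relaxation with `η/2`
    set i := j + J with hidef
    obtain ⟨hcl, hτ, hper⟩ := hsol i
    have hI := (impulseGrid_gridInjectionIdentity Λ (ν i) c Φ Ψ G (u i 0) (u i) (hν i) hΦ hΨ hG hΨinv
      hGinv hG0 hGdiv hΨ' (hLH i) (hsup' i)).1
    rw [hnorm] at hI
    have hA : Λ.longTimeAvg (fun t => ∫ x, ⟪G x, u i t x⟫) = (τ i)⁻¹ * ∫ t in (0 : ℝ)..τ i, ∫ x, ⟪G x, u i t x⟫ :=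
      longTimeAvg_eq_periodMean Λ hper hτ fun v => ∫ x, ⟪G x, v x⟫
    have hF : Λ.longTimeAvg (fun t => ∫ x, ⟪Φ x • G x, u i t x⟫) =
        (τ i)⁻¹ * (ν i * ∫ t in (0 : ℝ)..τ i, gradNormSq (u i t)) := by
      rw [longTimeAvg_eq_periodMean Λ hper hτ fun v => ∫ x, ⟪Φ x • G x, v x⟫,
        period_work_eq_dissipation hcl hper hτ]
    have hL : Λ.longTimeAvg (fun t => ∫ x, ⟪u i t x, Torus.laplacian (fun y => Ψ y • G y) x⟫) =
        (τ i)⁻¹ * ∫ t in (0 : ℝ)..τ i, ∫ x, ⟪u i t x, Torus.laplacian (fun y => Ψ y • G y) x⟫ :=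
      longTimeAvg_eq_periodMean Λ hper hτ fun v => ∫ x, ⟪v x, Torus.laplacian (fun y => Ψ y • G y) x⟫
    -- detuned work `W = ν D − A`
    have hW := period_detunedWork_eq hcl hΦ hG hper hτ
    set A := ∫ t in (0 : ℝ)..τ i, ∫ x, ⟪G x, u i t x⟫ with hAdef
    set D := ∫ t in (0 : ℝ)..τ i, gradNormSq (u i t) with hDdef
    set L := ∫ t in (0 : ℝ)..τ i, ∫ x, ⟪u i t x, Torus.laplacian (fun y => Ψ y • G y) x⟫ with hLdef
    set W := ∫ t in (0 : ℝ)..τ i, ∫ x, (Φ x - 1) * ⟪G x, u i t x⟫ with hWdef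
    have hbi : τ i * η ≤ c * W := hb i
    -- `|L| ≤ τ K₀`
    have hLb : |L| ≤ K₀ * τ i := by
      have h := intervalIntegral.norm_integral_le_of_norm_le_const (a := (0 : ℝ)) (b := τ i) (C := K₀)
        (f := fun t => ∫ x, ⟪u i t x, Torus.laplacian (fun y => Ψ y • G y) x⟫) fun t ht => by
          rw [Real.norm_eq_abs]
          rw [uIoc_of_le hτ.le] at ht
          exact hLt i t ht.1.le
      rw [sub_zero, abs_of_pos hτ, Real.norm_eq_abs] at h
      exact h
    have hτinv : 0 < (τ i)⁻¹ := inv_pos.2 hτ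
    have key : Λ.longTimeAvg (fun t => ∫ x, ⟪u i t x - c • EuclideanSpace.single 0 1,
        Torus.convect (fun y => u i t y - c • EuclideanSpace.single 0 1) (fun y => Ψ y • G y) x⟫) =
        -((τ i)⁻¹ * (c * W + ν i * L)) := by
      rw [hA, hF, hL] at hI
      rw [hW]
      linear_combination hI
    rw [key]
    -- `−τ⁻¹ (c W + ν L) ≤ −η + ν K₀ ≤ −η/2`
    have h1 : (τ i)⁻¹ * (c * W) ≥ η := by
      calc η = (τ i)⁻¹ * (τ i * η) := by field_simp
        _ ≤ (τ i)⁻¹ * (c * W) := mul_le_mul_of_nonneg_left hbi hτinv.le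
    have h2 : |(τ i)⁻¹ * (ν i * L)| ≤ ν i * K₀ := by
      rw [abs_mul, abs_mul, abs_of_pos hτinv, abs_of_pos (hν i)]
      calc (τ i)⁻¹ * (ν i * |L|) ≤ (τ i)⁻¹ * (ν i * (K₀ * τ i)) :=
            mul_le_mul_of_nonneg_left (mul_le_mul_of_nonneg_left hLb (hν i).le) hτinv.le
        _ = ν i * K₀ := by field_simp
    have h3 : ν i * K₀ ≤ η / 2 := hsmall i (Nat.le_add_left J j)
    have h4 := neg_abs_le ((τ i)⁻¹ * (ν i * L))
    rw [mul_add]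
    linarith

end Transfer

end Summit.AnomalousDissipation.AnomalousDissipation.Theorems.ImpulseGridGridSigns

end
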